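import Summits.Ventures.HSemireg.WedgeHankelRecurrenceGaussAssociatedInterlace

/-!
# Venture HSemireg — **THE SECULAR EQUATION OF A RANK-ONE DIAGONAL CHANGE (Golub)**: raising `a_i` by `c` turns `q_N` (`N = m + i + 1`) into `q'_N = q_N − c·M` with the MINOR POLYNOMIAL
# `M = q_i · Q_m` (monic of degree `N − 1`; `Q` the associated polynomials of order `i + 1`); by Lagrange's partial fractions `q'_N(y)∕q_N(y) = 1 − c Σ_k ρ_k∕(y − x_k)` off the zeros `x_k` of
# `q_N`, with WEIGHTS `ρ_k = M(x_k)∕q_N'(x_k) = (b_{i+1}⋯b_{N−1}) q_i(x_k)² ∕ (q_{N−1}(x_k) q_N'(x_k)) ≥ 0` summing to `1` — the zeros of `q'_N` are the roots of `c Σ_k ρ_k∕(y − x_k) = 1`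
# (N288's Stieltjes–Pick expansion of `q_{N−1}∕q_N` is the case `i = N − 1`)

HONEST FRAMING. Part of the Lean index of the computation cell `pub-hsemireg` (seat p10 gen 45, Sunday typer «UNIFORM-IN-n»).  Real polynomials and finite sums only (Lagrange interpolation via
`Polynomial.eq_of_degrees_lt_of_eval_index_eq`); no variety, no cohomology theory, no sheaf, no Ext group and no semiregularity map is constructed here; nothing here says that HC / HC_CM / HC_AV
holds; no Literature fact (unproved `Prop`) is declared or used.  Custodian versions as in `WedgeHankelSiegelIdeal` (1/3).
SOURCES (cited).  G. H. Golub, *Some modified matrix eigenvalue problems*, SIAM Rev. 15 (1973) 318–334, §5 (the secular equation `1 + σ Σ u_k²∕(d_k − λ) = 0` of a rank-one modification);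
J. R. Bunch, C. P. Nielsen, D. C. Sorensen, *Rank-one modification of the symmetric eigenproblem*, Numer. Math. 31 (1978) 31–48, §2; J. H. Wilkinson, *The Algebraic Eigenvalue Problem* (1965)
Ch. 2 §§39–43; for the partial fractions G. Szegő, *Orthogonal Polynomials*, Thm 3.3.5 and (14.2.1)–(14.2.2) (Lagrange interpolation at the zeros).
PROOF TYPED HERE.  Lagrange: a polynomial of degree `≤ n` equals `Σ_k P(y_k)∕D_k · ∏_{j≠k}(X − y_j)` (`D_k = ∏_{j≠k}(y_k − y_j)`, both sides agree at the `n + 1` nodes), hence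
`P(y)∕∏(y − y_j) = Σ_k (P(y_k)∕D_k)∕(y − y_k)` and `Σ_k P(y_k)∕D_k = coeff_n P`; applied to `M` with N347 `rank_one_perturbation_eq`; the weights by N347's Casoratian
(`M(x_k) q_{N−1}(x_k) = (∏ b) q_i(x_k)²`), N274 `recurrence_no_common_root` and the Christoffel–Darboux positivity `q_N'(x_k) q_{N−1}(x_k) > 0` (N274).
DEDUP DISCLOSURE (`rg -n 'secular|lagrange_partial|eval_div_prod' Summits/Ventures/HSemireg`, 2026-09-03): N288 (`recurrence_ratio_eq_sum_div`: `q_n∕q_{n+1}`), N347 (`rank_one_secular_value`: the value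
AT the zeros); the general Lagrange partial fraction and the secular equation off the zeros are new.  The 9 names below: 0 hits tree-wide.

WHAT IS IN THE TREE.  N347 `rank_one_perturbation_eq`, `associated_eval_at_zero`; N274 `recurrence_no_common_root`, `recurrence_christoffel_darboux_confluent_pos`; N279 `recurrence_monic_natDegree`;
N284 `eval_derivative_prod_X_sub_C_at_node`; Mathlib `Polynomial.eq_of_degrees_lt_of_eval_index_eq`.
THIS FILE (namespace `Summit.Ventures.HSemireg.Wedge.HankelOuter` continued; CHAINED on N356 (import only); 0 definitions):
* §1122 **`lagrange_partial_fraction_poly`** (`P = Σ_k C(P(y_k)∕D_k) ∏_{j≠k}(X − y_j)` for `deg P ≤ n`, `n + 1` distinct nodes), `lagrange_partial_fraction_eval` (`P(y)∕∏(y − y_j) = Σ_k (P(y_k)∕D_k)∕(y − y_k)`),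
  `lagrange_sum_weights_eq_coeff` (`Σ_k P(y_k)∕D_k = coeff_n P`), `minor_eval_mul_eq` (`M(ξ) q_{N−1}(ξ) = (∏ b) q_i(ξ)²` at a zero of `q_N`), **`rank_one_secular_equation`**
  (`q'_N(y)∕q_N(y) = 1 − c Σ_k ρ_k∕(y − x_k)`), **`rank_one_secular_weight_eq`** (`ρ_k = (∏ b) q_i(x_k)²∕(q_{N−1}(x_k) q_N'(x_k))`), **`rank_one_secular_weight_nonneg`** (`ρ_k ≥ 0`),
  **`rank_one_secular_weights_sum`** (`Σ ρ_k = 1`), **`rank_one_top_displacement_ge`** (`c ρ_{N−1} ≤ y_{N−1} − x_{N−1}`).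
CAVEATS.  Positive recurrences for the weight statements; the Lagrange lemmas need only distinct nodes.  Nothing Ext-side.  New names only.
-/

open Module Polynomial
open scoped Matrix Polynomial

namespace Summit.Ventures.HSemireg.Wedge.HankelOuter

/-! ## §1122. Lagrange partial fractions and the rank-one secular equation -/

/-- **LAGRANGE'S FORMULA AS A PARTIAL-FRACTION NUMERATOR: `P = Σ_k C(P(y_k)∕D_k) · ∏_{j≠k}(X − y_j)`**, `D_k = ∏_{j≠k}(y_k − y_j)`, for `deg P ≤ n` and `n + 1` distinct nodes. [Szegő (14.2.1);
this file, §1122] -/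
theorem lagrange_partial_fraction_poly {n : ℕ} {y : Fin (n + 1) → ℝ} (hy : Function.Injective y) {P : ℝ[X]} (hP : P.natDegree ≤ n) :
    P = ∑ k, C (P.eval (y k) / ∏ j ∈ Finset.univ.erase k, (y k - y j)) * ∏ j ∈ Finset.univ.erase k, (Polynomial.X - C (y j)) := by
  have hys : Set.InjOn y (Finset.univ : Finset (Fin (n + 1))) := hy.injOn.mono (Set.subset_univ _)
  refine eq_of_degrees_lt_of_eval_index_eq Finset.univ hys ?_ ?_ fun i _ => ?_
  · rw [Finset.card_univ, Fintype.card_fin]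
    exact lt_of_le_of_lt degree_le_natDegree (by exact_mod_cast Nat.lt_succ_of_le hP)
  · rw [Finset.card_univ, Fintype.card_fin]
    have hnat : (∑ k, C (P.eval (y k) / ∏ j ∈ Finset.univ.erase k, (y k - y j)) * ∏ j ∈ Finset.univ.erase k, (Polynomial.X - C (y j))).natDegree ≤ n := by
      refine natDegree_sum_le_of_forall_le _ _ fun k _ => (natDegree_C_mul_le _ _).trans ?_
      rw [natDegree_prod_of_monic _ _ fun j _ => monic_X_sub_C (y j)]
      simp only [natDegree_X_sub_C, Finset.sum_const, Finset.card_erase_of_mem (Finset.mem_univ k), Finset.card_univ, Fintype.card_fin, smul_eq_mul, mul_one]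
      omega
    exact lt_of_le_of_lt degree_le_natDegree (by exact_mod_cast Nat.lt_succ_of_le hnat)
  · rw [eval_finsetSum, Finset.sum_eq_single i (fun k _ hki => by
        rw [eval_mul, eval_C, eval_prod]
        exact mul_eq_zero_of_right _ (Finset.prod_eq_zero (Finset.mem_erase.2 ⟨Ne.symm hki, Finset.mem_univ i⟩) (by rw [eval_sub, eval_X, eval_C, sub_self])))
      (fun h => absurd (Finset.mem_univ i) h), eval_mul, eval_C, eval_prod]
    have hprod : ∏ j ∈ Finset.univ.erase i, (Polynomial.X - C (y j)).eval (y i) = ∏ j ∈ Finset.univ.erase i, (y i - y j) :=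
      Finset.prod_congr rfl fun j _ => by rw [eval_sub, eval_X, eval_C]
    have hne : ∏ j ∈ Finset.univ.erase i, (y i - y j) ≠ 0 :=
      Finset.prod_ne_zero_iff.2 fun j hj => sub_ne_zero.2 fun e => (Finset.mem_erase.1 hj).1 (hy e).symm
    rw [hprod, div_mul_cancel₀ _ hne]

/-- **`P(y)∕∏_j (y − y_j) = Σ_k (P(y_k)∕D_k)∕(y − y_k)`** off the nodes. [Szegő (14.2.2); this file, §1122] -/
theorem lagrange_partial_fraction_eval {n : ℕ} {y : Fin (n + 1) → ℝ} (hy : Function.Injective y) {P : ℝ[X]} (hP : P.natDegree ≤ n) {z : ℝ} (hz : ∀ j, z ≠ y j) :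
    P.eval z / (∏ j, (Polynomial.X - C (y j))).eval z = ∑ k, (P.eval (y k) / ∏ j ∈ Finset.univ.erase k, (y k - y j)) / (z - y k) := by
  conv_lhs => rw [lagrange_partial_fraction_poly hy hP]
  rw [eval_finsetSum, Finset.sum_div]
  refine Finset.sum_congr rfl fun k _ => ?_
  have hsplit : (z - y k) * (∏ j ∈ Finset.univ.erase k, (Polynomial.X - C (y j))).eval z = (∏ j, (Polynomial.X - C (y j))).eval z := by
    have h := Finset.mul_prod_erase Finset.univ (fun j => (Polynomial.X - C (y j)).eval z) (Finset.mem_univ k)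
    rw [eval_sub, eval_X, eval_C] at h
    rw [eval_prod, eval_prod]
    exact h
  have h1 : z - y k ≠ 0 := sub_ne_zero.2 (hz k)
  have h2 : (∏ j ∈ Finset.univ.erase k, (Polynomial.X - C (y j))).eval z ≠ 0 := by
    rw [eval_prod]; exact Finset.prod_ne_zero_iff.2 fun j _ => by rw [eval_sub, eval_X, eval_C]; exact sub_ne_zero.2 (hz j)
  rw [eval_mul, eval_C, ← hsplit]
  field_simp

/-- **`Σ_k P(y_k)∕D_k = coeff_n P`** (compare the coefficients of `X^n` in Lagrange's formula). [this file, §1122] -/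
theorem lagrange_sum_weights_eq_coeff {n : ℕ} {y : Fin (n + 1) → ℝ} (hy : Function.Injective y) {P : ℝ[X]} (hP : P.natDegree ≤ n) :
    ∑ k, P.eval (y k) / ∏ j ∈ Finset.univ.erase k, (y k - y j) = P.coeff n := by
  have h := congrArg (fun R => R.coeff n) (lagrange_partial_fraction_poly hy hP)
  rw [finsetSum_coeff] at h
  rw [h]
  refine Finset.sum_congr rfl fun k _ => ?_
  have hm : (∏ j ∈ Finset.univ.erase k, (Polynomial.X - C (y j))).Monic := monic_prod_of_monic _ _ fun j _ => monic_X_sub_C (y j)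
  have hd : (∏ j ∈ Finset.univ.erase k, (Polynomial.X - C (y j))).natDegree = n := by
    rw [natDegree_prod_of_monic _ _ fun j _ => monic_X_sub_C (y j)]
    simp only [natDegree_X_sub_C, Finset.sum_const, Finset.card_erase_of_mem (Finset.mem_univ k), Finset.card_univ, Fintype.card_fin, smul_eq_mul, mul_one]
    omega
  have hc : (∏ j ∈ Finset.univ.erase k, (Polynomial.X - C (y j))).coeff n = 1 := by have := hm.coeff_natDegree; rwa [hd] at this
  rw [coeff_C_mul, hc, mul_one]

/-- **The minor polynomial at a zero: `(q_i Q_m)(ξ) · q_{m+i}(ξ) = (b_{i+1}⋯b_{m+i}) · q_i(ξ)²` whenever `q_{m+i+1}(ξ) = 0`** (`Q` the associated polynomials of order `i + 1`).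
[N347's Casoratian; this file, §1122] -/
theorem minor_eval_mul_eq {q Q : ℕ → ℝ[X]} {a b A B : ℕ → ℝ}
    (hrec : ∀ n, q (n + 2) = (Polynomial.X - C (a (n + 1))) * q (n + 1) - C (b (n + 1)) * q n)
    (hQ0 : Q 0 = 1) (hQ1 : Q 1 = Polynomial.X - C (A 0)) (hQrec : ∀ n, Q (n + 2) = (Polynomial.X - C (A (n + 1))) * Q (n + 1) - C (B (n + 1)) * Q n)
    (i : ℕ) (hA : ∀ n, A n = a (n + i + 1)) (hB : ∀ n, B n = b (n + i + 1)) (m : ℕ) {ξ : ℝ} (hξ : (q (m + i + 1)).eval ξ = 0) :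
    (q i * Q m).eval ξ * (q (m + i)).eval ξ = (∏ l ∈ Finset.Ico (i + 1) (m + i + 1), b l) * ((q i).eval ξ) ^ 2 := by
  rcases m with _ | m
  · rw [hQ0, mul_one, zero_add, Finset.Ico_self, Finset.prod_empty, one_mul, sq]
  · have h := associated_eval_at_zero hrec hQ0 hQ1 hQrec i hA hB m (by rw [show m + i + 2 = m + 1 + i + 1 by ring]; exact hξ)
    rw [show m + 1 + i + 1 = m + i + 2 by ring, show m + 1 + i = m + i + 1 by ring, eval_mul]
    calc (q i).eval ξ * (Q (m + 1)).eval ξ * (q (m + i + 1)).eval ξ = (q i).eval ξ * ((q (m + i + 1)).eval ξ * (Q (m + 1)).eval ξ) := by ring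
      _ = _ := by rw [h]; ring

/-- **THE SECULAR EQUATION: `q'_N(y)∕q_N(y) = 1 − c Σ_k ρ_k∕(y − x_k)`** off the zeros `x_k` of `q_N` (`N = m + i + 1`, `a'_i = a_i + c`, `ρ_k = (q_i Q_m)(x_k)∕q_N'(x_k)` with
`q_N' = dq_N∕dX` written as `∏_{j≠k}(x_k − x_j)`). [Golub 1973 §5; Bunch–Nielsen–Sorensen 1978 §2; this file, §1122] -/
theorem rank_one_secular_equation {q q' Q : ℕ → ℝ[X]} {a a' b A B : ℕ → ℝ} (hq0 : q 0 = 1) (hq1 : q 1 = Polynomial.X - C (a 0))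
    (hrec : ∀ n, q (n + 2) = (Polynomial.X - C (a (n + 1))) * q (n + 1) - C (b (n + 1)) * q n)
    (hq0' : q' 0 = 1) (hq1' : q' 1 = Polynomial.X - C (a' 0)) (hrec' : ∀ n, q' (n + 2) = (Polynomial.X - C (a' (n + 1))) * q' (n + 1) - C (b (n + 1)) * q' n)
    (hQ0 : Q 0 = 1) (hQ1 : Q 1 = Polynomial.X - C (A 0)) (hQrec : ∀ n, Q (n + 2) = (Polynomial.X - C (A (n + 1))) * Q (n + 1) - C (B (n + 1)) * Q n)
    {i : ℕ} (hA : ∀ n, A n = a (n + i + 1)) (hB : ∀ n, B n = b (n + i + 1)) {c : ℝ} (hc : a' i = a i + c) (ha : ∀ n, n ≠ i → a' n = a n)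
    (m : ℕ) {x : Fin (m + i + 1) → ℝ} (hx : StrictMono x) (hxq : q (m + i + 1) = ∏ k, (Polynomial.X - C (x k))) {y : ℝ} (hy : ∀ k, y ≠ x k) :
    (q' (m + i + 1)).eval y / (q (m + i + 1)).eval y = 1 - c * ∑ k, ((q i * Q m).eval (x k) / ∏ j ∈ Finset.univ.erase k, (x k - x j)) / (y - x k) := by
  have hqy : (q (m + i + 1)).eval y ≠ 0 := by
    rw [hxq, eval_prod]; exact Finset.prod_ne_zero_iff.2 fun k _ => by rw [eval_sub, eval_X, eval_C]; exact sub_ne_zero.2 (hy k)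
  have hMd : (q i * Q m).natDegree ≤ m + i := by
    obtain ⟨hqm, hqd⟩ := recurrence_monic_natDegree hq0 hq1 hrec i
    obtain ⟨hQm, hQd⟩ := recurrence_monic_natDegree hQ0 hQ1 hQrec m
    rw [hqm.natDegree_mul hQm, hqd, hQd]; omega
  rw [rank_one_perturbation_eq hq0 hq1 hrec hq0' hq1' hrec' hQ0 hQ1 hQrec hA hB hc ha m, eval_sub, sub_div, div_self hqy, mul_assoc, eval_mul, eval_C, mul_div_assoc,
    ← lagrange_partial_fraction_eval hx.injective hMd hy, hxq]

/-- **THE SECULAR WEIGHTS: `ρ_k = (b_{i+1}⋯b_{N−1}) q_i(x_k)² ∕ (q_{N−1}(x_k) · ∏_{j≠k}(x_k − x_j))`** (positive `b`). [Golub 1973 §5; this file, §1122] -/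
theorem rank_one_secular_weight_eq {q Q : ℕ → ℝ[X]} {a b A B : ℕ → ℝ} (hq0 : q 0 = 1) (hq1 : q 1 = Polynomial.X - C (a 0))
    (hrec : ∀ n, q (n + 2) = (Polynomial.X - C (a (n + 1))) * q (n + 1) - C (b (n + 1)) * q n)
    (hQ0 : Q 0 = 1) (hQ1 : Q 1 = Polynomial.X - C (A 0)) (hQrec : ∀ n, Q (n + 2) = (Polynomial.X - C (A (n + 1))) * Q (n + 1) - C (B (n + 1)) * Q n)
    (hb : ∀ j, 0 < b j) {i : ℕ} (hA : ∀ n, A n = a (n + i + 1)) (hB : ∀ n, B n = b (n + i + 1))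
    (m : ℕ) {x : Fin (m + i + 1) → ℝ} (hxq : q (m + i + 1) = ∏ k, (Polynomial.X - C (x k))) (k : Fin (m + i + 1)) :
    (q i * Q m).eval (x k) / ∏ j ∈ Finset.univ.erase k, (x k - x j) =
      (∏ l ∈ Finset.Ico (i + 1) (m + i + 1), b l) * ((q i).eval (x k)) ^ 2 / ((q (m + i)).eval (x k) * ∏ j ∈ Finset.univ.erase k, (x k - x j)) := by
  have hxr : (q (m + i + 1)).eval (x k) = 0 := by
    rw [hxq, eval_prod]; exact Finset.prod_eq_zero (Finset.mem_univ k) (by rw [eval_sub, eval_X, eval_C, sub_self])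
  have hne : (q (m + i)).eval (x k) ≠ 0 := fun h0 => recurrence_no_common_root hq0 hq1 hrec hb (m + i) h0 hxr
  have h := minor_eval_mul_eq hrec hQ0 hQ1 hQrec i hA hB m hxr
  rw [← h, mul_comm ((q (m + i)).eval (x k)), mul_div_mul_right _ _ hne]

/-- **The secular weights are non-negative** (`q_N'(x_k) q_{N−1}(x_k) > 0` by Christoffel–Darboux; `ρ_k = 0` exactly when `q_i(x_k) = 0`). [Golub 1973 §5; this file, §1122] -/
theorem rank_one_secular_weight_nonneg {q Q : ℕ → ℝ[X]} {a b A B : ℕ → ℝ} (hq0 : q 0 = 1) (hq1 : q 1 = Polynomial.X - C (a 0))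
    (hrec : ∀ n, q (n + 2) = (Polynomial.X - C (a (n + 1))) * q (n + 1) - C (b (n + 1)) * q n)
    (hQ0 : Q 0 = 1) (hQ1 : Q 1 = Polynomial.X - C (A 0)) (hQrec : ∀ n, Q (n + 2) = (Polynomial.X - C (A (n + 1))) * Q (n + 1) - C (B (n + 1)) * Q n)
    (hb : ∀ j, 0 < b j) {i : ℕ} (hA : ∀ n, A n = a (n + i + 1)) (hB : ∀ n, B n = b (n + i + 1))
    (m : ℕ) {x : Fin (m + i + 1) → ℝ} (hxq : q (m + i + 1) = ∏ k, (Polynomial.X - C (x k))) (k : Fin (m + i + 1)) :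
    0 ≤ (q i * Q m).eval (x k) / ∏ j ∈ Finset.univ.erase k, (x k - x j) := by
  have hxr : (q (m + i + 1)).eval (x k) = 0 := by
    rw [hxq, eval_prod]; exact Finset.prod_eq_zero (Finset.mem_univ k) (by rw [eval_sub, eval_X, eval_C, sub_self])
  rw [rank_one_secular_weight_eq hq0 hq1 hrec hQ0 hQ1 hQrec hb hA hB m hxq k]
  have hD : ∏ j ∈ Finset.univ.erase k, (x k - x j) = (derivative (q (m + i + 1))).eval (x k) := by rw [hxq, eval_derivative_prod_X_sub_C_at_node]
  have hpos : 0 < (q (m + i)).eval (x k) * ∏ j ∈ Finset.univ.erase k, (x k - x j) := by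
    have h := recurrence_christoffel_darboux_confluent_pos hq0 hq1 hrec hb (m + i) (x k)
    rw [hxr, mul_zero, sub_zero] at h
    rw [hD, mul_comm]; exact h
  exact div_nonneg (mul_nonneg (Finset.prod_nonneg fun l _ => (hb l).le) (sq_nonneg _)) hpos.le

/-- **The secular weights sum to `1`** (`q_i Q_m` is monic of degree `N − 1`). [Golub 1973 §5; this file, §1122] -/
theorem rank_one_secular_weights_sum {q Q : ℕ → ℝ[X]} {a b A B : ℕ → ℝ} (hq0 : q 0 = 1) (hq1 : q 1 = Polynomial.X - C (a 0))
    (hrec : ∀ n, q (n + 2) = (Polynomial.X - C (a (n + 1))) * q (n + 1) - C (b (n + 1)) * q n)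
    (hQ0 : Q 0 = 1) (hQ1 : Q 1 = Polynomial.X - C (A 0)) (hQrec : ∀ n, Q (n + 2) = (Polynomial.X - C (A (n + 1))) * Q (n + 1) - C (B (n + 1)) * Q n)
    (m i : ℕ) {x : Fin (m + i + 1) → ℝ} (hx : Function.Injective x) :
    ∑ k, (q i * Q m).eval (x k) / ∏ j ∈ Finset.univ.erase k, (x k - x j) = 1 := by
  obtain ⟨hqm, hqd⟩ := recurrence_monic_natDegree hq0 hq1 hrec i
  obtain ⟨hQm, hQd⟩ := recurrence_monic_natDegree hQ0 hQ1 hQrec m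
  have hMm : (q i * Q m).Monic := hqm.mul hQm
  have hMd : (q i * Q m).natDegree = m + i := by rw [hqm.natDegree_mul hQm, hqd, hQd]; ring
  rw [lagrange_sum_weights_eq_coeff hx hMd.le]
  have := hMm.coeff_natDegree; rwa [hMd] at this

/-- **THE TOP ZERO MOVES BY AT LEAST `c ρ_t`: `c · ρ_{N−1} ≤ y_{N−1} − x_{N−1}`** (and by at most `c`, N353) for the rank-one change `a_i ↦ a_i + c`, `c > 0` — read off the secular equation at
`y_{N−1} > x_k`, where every term is non-negative. [Golub 1973 §5; Wilkinson Ch. 2 §41; this file, §1122] -/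
theorem rank_one_top_displacement_ge {q q' Q : ℕ → ℝ[X]} {a a' b A B : ℕ → ℝ} (hq0 : q 0 = 1) (hq1 : q 1 = Polynomial.X - C (a 0))
    (hrec : ∀ n, q (n + 2) = (Polynomial.X - C (a (n + 1))) * q (n + 1) - C (b (n + 1)) * q n)
    (hq0' : q' 0 = 1) (hq1' : q' 1 = Polynomial.X - C (a' 0)) (hrec' : ∀ n, q' (n + 2) = (Polynomial.X - C (a' (n + 1))) * q' (n + 1) - C (b (n + 1)) * q' n)
    (hQ0 : Q 0 = 1) (hQ1 : Q 1 = Polynomial.X - C (A 0)) (hQrec : ∀ n, Q (n + 2) = (Polynomial.X - C (A (n + 1))) * Q (n + 1) - C (B (n + 1)) * Q n)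
    (hb : ∀ j, 0 < b j) {i : ℕ} (hA : ∀ n, A n = a (n + i + 1)) (hB : ∀ n, B n = b (n + i + 1)) {c : ℝ} (hc : a' i = a i + c) (hc0 : 0 < c) (ha : ∀ n, n ≠ i → a' n = a n)
    (m : ℕ) {x y : Fin (m + i + 1) → ℝ} (hx : StrictMono x) (hxq : q (m + i + 1) = ∏ k, (Polynomial.X - C (x k)))
    (hy : StrictMono y) (hyq : q' (m + i + 1) = ∏ k, (Polynomial.X - C (y k))) :
    c * ((q i * Q m).eval (x (Fin.last (m + i))) / ∏ j ∈ Finset.univ.erase (Fin.last (m + i)), (x (Fin.last (m + i)) - x j)) ≤ y (Fin.last (m + i)) - x (Fin.last (m + i)) := by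
  have hxr : ∀ k, (q (m + i + 1)).eval (x k) = 0 := fun k => by
    rw [hxq, eval_prod]; exact Finset.prod_eq_zero (Finset.mem_univ k) (by rw [eval_sub, eval_X, eval_C, sub_self])
  have hyr : ∀ k, (q' (m + i + 1)).eval (y k) = 0 := fun k => by
    rw [hyq, eval_prod]; exact Finset.prod_eq_zero (Finset.mem_univ k) (by rw [eval_sub, eval_X, eval_C, sub_self])
  have hle : x (Fin.last (m + i)) ≤ y (Fin.last (m + i)) :=
    (zeros_rank_one_interlace hq0 hq1 hrec hq0' hq1' hrec' hb (i₀ := i) (by rw [hc]; exact le_add_of_nonneg_right hc0.le) ha hx hxq hy hyq (Fin.last (m + i))).1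
  have hρ := rank_one_secular_weight_nonneg hq0 hq1 hrec hQ0 hQ1 hQrec hb hA hB m hxq
  rcases hle.eq_or_lt with heq | hlt
  · -- a common zero: `q_i` vanishes there and the weight is `0`
    have h0 : (q i).eval (x (Fin.last (m + i))) = 0 :=
      (rank_one_fixed_zero_iff hq0 hq1 hrec hq0' hq1' hrec' hQ0 hQ1 hQrec hb hA hB hc hc0.ne' ha m (hxr _)).1 (by rw [heq]; exact hyr _)
    rw [rank_one_secular_weight_eq hq0 hq1 hrec hQ0 hQ1 hQrec hb hA hB m hxq, h0, ← heq]
    simp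
  · -- `y_{N−1}` is right of every `x_k`: the secular equation has non-negative terms
    have hyx : ∀ k, y (Fin.last (m + i)) ≠ x k := fun k => ((hx.monotone (Fin.le_last k)).trans_lt hlt).ne'
    have hsec := rank_one_secular_equation hq0 hq1 hrec hq0' hq1' hrec' hQ0 hQ1 hQrec hA hB hc ha m hx hxq hyx
    rw [hyr, zero_div] at hsec
    have hsum : c * ∑ k, ((q i * Q m).eval (x k) / ∏ j ∈ Finset.univ.erase k, (x k - x j)) / (y (Fin.last (m + i)) - x k) = 1 := by linarith
    have hterm : ∀ k, 0 ≤ ((q i * Q m).eval (x k) / ∏ j ∈ Finset.univ.erase k, (x k - x j)) / (y (Fin.last (m + i)) - x k) := fun k =>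
      div_nonneg (hρ k) (sub_nonneg.2 ((hx.monotone (Fin.le_last k)).trans hlt.le))
    have h1 : c * (((q i * Q m).eval (x (Fin.last (m + i))) / ∏ j ∈ Finset.univ.erase (Fin.last (m + i)), (x (Fin.last (m + i)) - x j)) / (y (Fin.last (m + i)) - x (Fin.last (m + i)))) ≤ 1 := by
      rw [← hsum]
      exact mul_le_mul_of_nonneg_left (Finset.single_le_sum (fun k _ => hterm k) (Finset.mem_univ _)) hc0.le
    have hpos : 0 < y (Fin.last (m + i)) - x (Fin.last (m + i)) := sub_pos.2 hlt
    rw [mul_div_assoc', div_le_one hpos] at h1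
    exact h1

end Summit.Ventures.HSemireg.Wedge.HankelOuter
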